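import Mathlib
import HarnessLib
import Literature.Computability.AlgebraicComplexity.AsymptoticSpectrum
import Literature.Computability.AlgebraicComplexity.BorderRankCW
import Literature.Computability.AlgebraicComplexity.TensorRestrictionRank
import Literature.Computability.AlgebraicComplexity.KroneckerRank
import Literature.Computability.AlgebraicComplexity.CoppersmithWinograd1990Proofs
import Literature.Computability.AlgebraicComplexity.LaserMethodRestriction
import Literature.Computability.AlgebraicComplexity.LaserMethodTypeCount
import Literature.Computability.AlgebraicComplexity.MaxEntropyGivenMarginals
import Summits.MatrixMultiplication.MatrixMultiplication.Theorems.OutsiderSandwichHalfMMDiagonal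
import Summits.MatrixMultiplication.MatrixMultiplication.Theorems.OutsiderSandwichDegenerationWitnessRestrictions

/-!
# OutsiderSandwichHalfMM, part 2/3 — `⟨2,2,2⟩ ≤ cw₂ ⊠ ⟨2⟩` and the ω-free rate `4^{log₆ 3}`

Second file of the landing chain `OutsiderSandwichHalfMMDiagonal` → `OutsiderSandwichHalfMMFinite` →
`OutsiderSandwichHalfMM` for `route-MatrixMultiplication-OutsiderSandwich` (rev 3); imports no `Theses` file.
Land (after part 1) with

  `ledger propose --kind proof --target Summits/MatrixMultiplication/MatrixMultiplication/Theorems/OutsiderSandwichHalfMMFinite.lean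
     --file OutsiderSandwichHalfMMFinite.lean --supports stmt-MatrixMultiplication-28620`

CONTENT (sorry-free, no hypothesis).  (1) The exact identity `⟨2,2,2⟩ ≤ cw₂ ⊠ ⟨2⟩ (= cw₂ ⊕ cw₂)` over `ℤ`
and `ℂ` (`halfMM_int_identity`, `halfMM`): a signed-monomial restriction, kernel-checked by `decide`.
(2) `⟨2⟩ ≤ cw₂`, hence the finite instance `I(2,2)`: `⟨2,2,2⟩ ≤ cw₂^{⊠2}` (`mmInCwTwoPow_two_two`).
(3) `cw₂^{⊠k} ⊠ ⟨2^k⟩ ≥ ⟨2^k,2^k,2^k⟩` for all `k ≥ 1` (`halfMM_pow'`).  (4) From any `DiagonalAchieved`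
(part 1): rate `c` per copy of `cw₂` for every `1 < c < 4^{log₆ 3} = 2.3397…` (`rate_of_halfMM_of_diagonal`)
and the numeric fact `9/4 < 4^{log₆ 3}`.

Sources: CoppersmithWinograd1990 (§11: `cw₂`, `⟨2⟩ ≤ cw₂`), Blaser2013 (§5.2: `⟨m⟩³ ⊠ ⟨m'⟩³ ≥ ⟨mm'⟩³`),
ConnerGesmundoLandsbergVentura2022 (§1).  The identity (1) itself: no source found (searches in the cell node
`NODE-g5.md`); it is elementary and checked by the kernel.
-/

set_option linter.dupNamespace false -- `MatrixMultiplication.MatrixMultiplication` (summit = problem, D-0017)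

namespace Summit.MatrixMultiplication.MatrixMultiplication.Theorems.OutsiderSandwichHalfMM

open scoped BigOperators
open Literature.Computability.AlgebraicComplexity
-- restriction plumbing landed meanwhile in `Theorems/OutsiderSandwichDegenerationWitnessRestrictions.lean`
-- (gate `dedup.landed`): reused by name, the local copies deleted.
open Summit.MatrixMultiplication.MatrixMultiplication.Theorems.OutsiderSandwichDegenerationWitness
  (cwPow_add_restrictsTo intCast_cwTensor intCast_unitTensor cwTwo_restrictsTo_unitTwo kroneckerPow_one_restrictsTo)

/-! ## Two relabelling lemmas (as in the kernel mirror; the first is the landed `cwPow_add_restrictsTo`, the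
second — `⟨m,m,m⟩ ⊗ ⟨m',m',m'⟩ ≥ ⟨mm',mm',mm'⟩`, landed in a route-importing module — is a local `have` in `halfMM_pow`) -/

/-! ## (g5) HALF A MATRIX PRODUCT PER COPY OF `cw₂`: `⟨2,2,2⟩ ≤ cw₂ ⊠ ⟨2⟩`

The new finite object of generation 5: the `2 × 2` matrix multiplication tensor is a RESTRICTION of the
direct sum of TWO copies of the little Coppersmith–Winograd tensor, `⟨2,2,2⟩ ≤ cw₂ ⊕ cw₂ = cw₂ ⊠ ⟨2⟩`,
by a SIGNED MONOMIAL map (each of the 18 host variables goes to `±` one of the 12 matrix entries; the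
12 host terms give the 8 terms of `tr(XYZ)` and two cancelling pairs; valid over every commutative ring):

  `tr(XYZ) = cw₂(X₁₁, X₂₁, X₁₂ | Y₂₂, Y₁₁, Y₁₂ | Z₁₂, Z₁₁, Z₂₁) + cw₂(X₂₂, X₁₂, X₂₁ | −Y₁₂, Y₂₁, −Y₂₂ | Z₁₁, Z₁₂, −Z₂₂)`,

where `cw₂(x|y|z) = x₀(y₁z₁ + y₂z₂) + x₁(y₀z₁ + y₁z₀) + x₂(y₀z₂ + y₂z₀)`.  Consequences proved here:
`I(2,2)` = `⟨2,2,2⟩ ≤ cw₂^{⊠2}` (rate `2` per copy), `cw₂^{⊠k} ⊠ ⟨2^k⟩ ≥ ⟨2^k,2^k,2^k⟩` for all `k ≥ 1`,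
and — feeding the diagonal `⟨2^k⟩` from `Q̃(cw₂) = 3` (`DiagonalAchieved`) — the ω-FREE RATE
`q* ≥ 2·log₆ 3 = 1.2263` bits per copy, i.e. `CwTwoRate c` for every `c < 4^{log₆ 3} = 2.3397`
(kernel before: `4^{1/3} = 1.5874`; print via laser-merge at the record `ω̄`: `2.7153`; TOP: `3`). -/

section HalfMM

/-- `x`-slot map of the half-MM identity: host variable `(h,u) ∈ Fin 3 × Fin 2` (`cw₂`-index `h`, copy
`u`) ↦ the `matMulTensor` slot-1 index `(κ,ν)` it is sent to. [new] -/
def hmTA : Fin 3 → Fin 2 → Fin 2 × Fin 2 := ![![(0,0),(1,1)], ![(0,1),(1,0)], ![(1,0),(0,1)]]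
/-- `y`-slot map (slot 2, index `(κ,μ)`). [new] -/
def hmTB : Fin 3 → Fin 2 → Fin 2 × Fin 2 := ![![(1,1),(0,1)], ![(0,0),(1,0)], ![(0,1),(1,1)]]
/-- `z`-slot map (slot 3, index `(μ,ν)`). [new] -/
def hmTC : Fin 3 → Fin 2 → Fin 2 × Fin 2 := ![![(0,1),(0,0)], ![(0,0),(0,1)], ![(1,0),(1,1)]]
/-- signs of the `y`-slot map. [new] -/
def hmSB : Fin 3 → Fin 2 → ℤ := ![![1,-1], ![1,1], ![1,-1]]
/-- signs of the `z`-slot map. [new] -/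
def hmSC : Fin 3 → Fin 2 → ℤ := ![![1,1], ![1,1], ![1,-1]]
/-- the three restriction matrices over `ℤ` (one `±1` per host column). [new] -/
def hmA (p : Fin 2 × Fin 2) (a : Fin 3 × Fin 2) : ℤ := if hmTA a.1 a.2 = p then 1 else 0
/-- see `hmA`. [new] -/
def hmB (p : Fin 2 × Fin 2) (a : Fin 3 × Fin 2) : ℤ := if hmTB a.1 a.2 = p then hmSB a.1 a.2 else 0
/-- see `hmA`. [new] -/
def hmC (p : Fin 2 × Fin 2) (a : Fin 3 × Fin 2) : ℤ := if hmTC a.1 a.2 = p then hmSC a.1 a.2 else 0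

set_option maxRecDepth 4000 in
/-- **The half-MM identity over `ℤ`**: `⟨2,2,2⟩ = (hmA ⊗ hmB ⊗ hmC)·(cw₂ ⊠ ⟨2⟩)` entrywise — all
`64` target entries against the `216` host triples, by `decide`. [new] -/
theorem halfMM_int_identity : ∀ a' b' c' : Fin 2 × Fin 2,
    matMulTensor ℤ 2 2 2 a' b' c' = ∑ a : Fin 3 × Fin 2, ∑ b : Fin 3 × Fin 2, ∑ c : Fin 3 × Fin 2,
      hmA a' a * hmB b' b * hmC c' c * kroneckerTensor (cwTensor ℤ 2) (unitTensor ℤ 2) a b c := by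
  decide

/-- cast `ℤ → ℂ` of the matrix multiplication tensor. [folklore] -/
theorem intCast_matMulTensor (k m n : ℕ) (a : Fin k × Fin n) (b : Fin k × Fin m) (c : Fin m × Fin n) :
    ((matMulTensor ℤ k m n a b c : ℤ) : ℂ) = matMulTensor ℂ k m n a b c := by
  unfold matMulTensor; split_ifs <;> simp

/-- **`⟨2,2,2⟩ ≤ cw₂ ⊠ ⟨2⟩` (`= cw₂ ⊕ cw₂`) over `ℂ`** — half a `2 × 2` matrix product per copy of the
little Coppersmith–Winograd tensor, as an honest restriction (not a degeneration). [new] -/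
theorem halfMM :
    TensorRestrictsTo (kroneckerTensor (cwTensor ℂ 2) (unitTensor ℂ 2)) (matMulTensor ℂ 2 2 2) := by
  refine ⟨fun p a => (hmA p a : ℂ), fun p a => (hmB p a : ℂ), fun p a => (hmC p a : ℂ),
    fun a' b' c' => ?_⟩
  have h := congrArg (fun z : ℤ => (z : ℂ)) (halfMM_int_identity a' b' c')
  simpa only [Int.cast_sum, Int.cast_mul, intCast_matMulTensor, kroneckerTensor_apply,
    intCast_cwTensor, intCast_unitTensor] using h

/-- **`I(2,2)` in kernel: `⟨2,2,2⟩ ≤ cw₂^{⊠2}`** (`cw₂^{⊠2} ≥ cw₂ ⊠ cw₂ ≥ cw₂ ⊠ ⟨2⟩ ≥ ⟨2,2,2⟩`): rate `2`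
per copy (`m² = 4 = 2²`), against the flattening ceiling `3² = 9`. [new] -/
theorem mmInCwTwoPow_two_two :
    TensorRestrictsTo (kroneckerPow (cwTensor ℂ 2) 2) (matMulTensor ℂ 2 2 2) :=
  ((cwPow_add_restrictsTo 1 1).trans
    ((kroneckerPow_one_restrictsTo _).kronecker
      ((kroneckerPow_one_restrictsTo _).trans cwTwo_restrictsTo_unitTwo))).trans halfMM

/-- `(A ⊠ B) ⊠ (C ⊠ D) ≥ (A ⊠ C) ⊠ (B ⊠ D)` (middle-four interchange, a relabelling). [folklore] -/
theorem kronecker_shuffle {ι₁ κ₁ μ₁ ι₂ κ₂ μ₂ ι₃ κ₃ μ₃ ι₄ κ₄ μ₄ : Type} [Fintype ι₁] [Fintype κ₁]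
    [Fintype μ₁] [Fintype ι₂] [Fintype κ₂] [Fintype μ₂] [Fintype ι₃] [Fintype κ₃] [Fintype μ₃]
    [Fintype ι₄] [Fintype κ₄] [Fintype μ₄] (A : ι₁ → κ₁ → μ₁ → ℂ) (B : ι₂ → κ₂ → μ₂ → ℂ)
    (C : ι₃ → κ₃ → μ₃ → ℂ) (D : ι₄ → κ₄ → μ₄ → ℂ) :
    TensorRestrictsTo (kroneckerTensor (kroneckerTensor A B) (kroneckerTensor C D))
      (kroneckerTensor (kroneckerTensor A C) (kroneckerTensor B D)) := by
  classical
  have e : kroneckerTensor (kroneckerTensor A C) (kroneckerTensor B D) = fun a b c =>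
      kroneckerTensor (kroneckerTensor A B) (kroneckerTensor C D) ((a.1.1, a.2.1), (a.1.2, a.2.2))
        ((b.1.1, b.2.1), (b.1.2, b.2.2)) ((c.1.1, c.2.1), (c.1.2, c.2.2)) := by
    funext a b c
    simp only [kroneckerTensor_apply]
    ring
  rw [e]
  exact tensorRestrictsTo_precomp _ _ _ _

/-- `⟨F·r⟩ ≥ ⟨F⟩ ⊠ ⟨r⟩` (relabelling by `finProdFinEquiv`). [folklore] -/
theorem unitTensor_mul_restrictsTo (F r : ℕ) :
    TensorRestrictsTo (unitTensor ℂ (F * r)) (kroneckerTensor (unitTensor ℂ F) (unitTensor ℂ r)) := by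
  have e : kroneckerTensor (unitTensor ℂ F) (unitTensor ℂ r) = fun a b c =>
      unitTensor ℂ (F * r) (finProdFinEquiv a) (finProdFinEquiv b) (finProdFinEquiv c) := by
    funext a b c
    simp only [kroneckerTensor_apply, unitTensor_apply, EmbeddingLike.apply_eq_iff_eq]
    obtain ⟨a1, a2⟩ := a; obtain ⟨b1, b2⟩ := b; obtain ⟨c1, c2⟩ := c
    simp only [Prod.mk.injEq]
    by_cases h2 : b1 = c1
    · subst h2
      by_cases h4 : b2 = c2
      · subst h4
        by_cases h1 : a1 = b1 <;> by_cases h3 : a2 = b2 <;> simp [h1, h3]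
      · simp [h4]
    · simp [h2]
  rw [e]
  exact tensorRestrictsTo_precomp _ _ _ _

/-- **`cw₂^{⊠(k+1)} ⊠ ⟨2^{k+1}⟩ ≥ ⟨2^{k+1}, 2^{k+1}, 2^{k+1}⟩`**: `k+1` half-products assembled
(`halfMM` per copy, `⟨m⟩³ ⊠ ⟨2⟩³ ≥ ⟨2m⟩³`). [new] -/
theorem halfMM_pow (k : ℕ) :
    TensorRestrictsTo (kroneckerTensor (kroneckerPow (cwTensor ℂ 2) (k + 1)) (unitTensor ℂ (2 ^ (k + 1))))
      (matMulTensor ℂ (2 ^ (k + 1)) (2 ^ (k + 1)) (2 ^ (k + 1))) := by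
  induction k with
  | zero => exact ((kroneckerPow_one_restrictsTo _).kronecker (TensorRestrictsTo.refl _)).trans halfMM
  | succ k ih =>
      -- `⟨m,m,m⟩ ⊗ ⟨m',m',m'⟩ ≥ ⟨mm',mm',mm'⟩` (double-index relabelling, Bläser 2013 §5.2 p. 24; the landed
      -- `OutsiderSandwichPackingProfile.matMul_kronecker_matMul_restrictsTo` lives in a route-importing module).
      have tensorRestrictsTo_kronecker_matMulTensor : ∀ m m' : ℕ,
          TensorRestrictsTo (kroneckerTensor (matMulTensor ℂ m m m) (matMulTensor ℂ m' m' m'))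
            (matMulTensor ℂ (m * m') (m * m') (m * m')) := by
        intro m m'
        have e : kroneckerTensor (matMulTensor ℂ m m m) (matMulTensor ℂ m' m' m') = fun a b c =>
            matMulTensor ℂ (m * m') (m * m') (m * m') (doubleIndexEquiv m m m' m' a)
              (doubleIndexEquiv m m m' m' b) (doubleIndexEquiv m m m' m' c) := by
          funext a b c
          exact kroneckerTensor_matMulTensor (K := ℂ) m m m m' m' m' a b c
        rw [e]
        exact tensorRestrictsTo_of_reindex (matMulTensor ℂ _ _ _) _ _ _
      have h := (((cwPow_add_restrictsTo (k + 1) 1).kronecker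
          (unitTensor_mul_restrictsTo (2 ^ (k + 1)) 2)).trans
        ((kronecker_shuffle _ _ _ _).trans
          ((ih.kronecker
              (((kroneckerPow_one_restrictsTo _).kronecker (TensorRestrictsTo.refl _)).trans halfMM)).trans
            (tensorRestrictsTo_kronecker_matMulTensor (2 ^ (k + 1)) 2))))
      rw [show 2 ^ (k + 1 + 1) = 2 ^ (k + 1) * 2 from pow_succ 2 (k + 1)]
      exact h

/-- `halfMM_pow` for every `k ≥ 1`. [new] -/
theorem halfMM_pow' {k : ℕ} (hk : 1 ≤ k) :
    TensorRestrictsTo (kroneckerTensor (kroneckerPow (cwTensor ℂ 2) k) (unitTensor ℂ (2 ^ k)))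
      (matMulTensor ℂ (2 ^ k) (2 ^ k) (2 ^ k)) := by
  obtain ⟨k', rfl⟩ : ∃ k', k = k' + 1 := ⟨k - 1, by omega⟩
  exact halfMM_pow k'

end HalfMM

/-! ## (g5) The ω-free rate `q* ≥ 2·log₆ 3`: `CwTwoRate c` for every `c < 4^{log₆ 3} = 2.3397`

Feed the diagonal of `halfMM_pow` from `Q̃(cw₂) = 3`: `cw₂^{⊠(k+N')} ≥ cw₂^{⊠k} ⊠ cw₂^{⊠N'} ≥
cw₂^{⊠k} ⊠ ⟨r⟩ ≥ cw₂^{⊠k} ⊠ ⟨2^k⟩ ≥ ⟨2^k⟩³` with `r ≥ 3^{(1-ε)N'}`, `2^k ≤ r < 2^{k+1}`, so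
`N = k + N' ≈ k(1 + log₃ 2)` copies buy `m² = 4^k`: rate `4^{1/(1+log₃2)} = 4^{log₆3}` per copy, i.e.
relative exponent `cw₂ → ⟨2,2,2⟩` at most `1 + log₃ 2 = 1.631` (tree lower bound `2/log₂3 = 1.262`,
equality iff TOP). -/

section Rate

/-- **ω-free rate from half-MM + diagonal.**  If `cw₂^{⊠N} ≥ ⟨r⟩` with `r ≥ 3^{(1-ε)N}` for `N` cofinal
(`Q̃(cw₂) = 3`, the hypothesis `hD`; PROVED in the kernel mirror as `diagonalAchieved`), then for every
`1 < c < 4^{log₆ 3}` and every `N₀` there are `N ≥ N₀`, `m` with `⟨m,m,m⟩ ≤ cw₂^{⊠N}` and `c^N ≤ m²`. [new] -/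
theorem rate_of_halfMM_of_diagonal
    (hD : ∀ ε : ℝ, 0 < ε → ∀ N₀ : ℕ, ∃ N : ℕ, N₀ ≤ N ∧ ∃ r : ℕ,
      TensorRestrictsTo (kroneckerPow (cwTensor ℂ 2) N) (unitTensor ℂ r) ∧
        (3 : ℝ) ^ ((1 - ε) * N) ≤ (r : ℝ))
    {c : ℝ} (hc1 : 1 < c) (hc : c < (4 : ℝ) ^ Real.logb 6 3) (N₀ : ℕ) :
    ∃ N : ℕ, N₀ ≤ N ∧ ∃ m : ℕ,
      TensorRestrictsTo (kroneckerPow (cwTensor ℂ 2) N) (matMulTensor ℂ m m m) ∧ c ^ N ≤ (m : ℝ) ^ 2 := by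
  have hcpos : 0 < c := by linarith
  have hL2 : 0 < Real.log 2 := Real.log_pos one_lt_two
  have hL3 : 0 < Real.log 3 := Real.log_pos (by norm_num)
  have hL23 : Real.log 2 ≤ Real.log 3 := Real.log_le_log two_pos (by norm_num)
  have hL4 : Real.log 4 = 2 * Real.log 2 := by
    rw [show (4 : ℝ) = 2 ^ 2 by norm_num, Real.log_pow]; push_cast; ring
  have hL4pos : 0 < Real.log 4 := by rw [hL4]; positivity
  have hL6 : Real.log 6 = Real.log 2 + Real.log 3 := by
    rw [show (6 : ℝ) = 2 * 3 by norm_num, Real.log_mul (by norm_num) (by norm_num)]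
  -- `Θ = log c / log 4 < log 3 / (log 2 + log 3) = log₆ 3`
  obtain ⟨Θ, hΘ⟩ : ∃ Θ : ℝ, Θ = Real.log c / Real.log 4 := ⟨_, rfl⟩
  have hΘpos : 0 < Θ := by rw [hΘ]; exact div_pos (Real.log_pos hc1) hL4pos
  have hΘL4 : Θ * Real.log 4 = Real.log c := by rw [hΘ]; exact div_mul_cancel₀ _ hL4pos.ne'
  have hΘlt : Θ * (Real.log 2 + Real.log 3) < Real.log 3 := by
    have h1 : Real.log c < Real.log ((4 : ℝ) ^ Real.logb 6 3) := Real.log_lt_log hcpos hc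
    rw [Real.log_rpow (by norm_num), Real.logb, hL6, ← hΘL4] at h1
    have h3 : Θ < Real.log 3 / (Real.log 2 + Real.log 3) := lt_of_mul_lt_mul_right h1 hL4pos.le
    rwa [lt_div_iff₀ (add_pos hL2 hL3)] at h3
  -- `Λ = log₃ 2`, the gap `g = 1 - Θ(1+Λ) > 0`
  obtain ⟨Λ, hΛ⟩ : ∃ Λ : ℝ, Λ = Real.log 2 / Real.log 3 := ⟨_, rfl⟩
  have hΛpos : 0 < Λ := by rw [hΛ]; exact div_pos hL2 hL3
  have hΛL : Λ * Real.log 3 = Real.log 2 := by rw [hΛ]; exact div_mul_cancel₀ _ hL3.ne'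
  have hΘΛ : Θ + Θ * Λ < 1 := by
    have h1 : (Θ + Θ * Λ) * Real.log 3 < 1 * Real.log 3 := by
      rw [add_mul, mul_assoc Θ Λ, hΛL, one_mul]; linarith
    exact lt_of_mul_lt_mul_right h1 hL3.le
  obtain ⟨g, hg⟩ : ∃ g : ℝ, g = 1 - Θ - Θ * Λ := ⟨_, rfl⟩
  have hgpos : 0 < g := by rw [hg]; linarith
  have hΘΛpos : 0 < Θ * Λ := mul_pos hΘpos hΛpos
  have hg1 : g < 1 := by rw [hg]; linarith
  have hΘΛ1 : Θ * Λ ≤ 1 := by linarith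
  -- the slack `E` given to the diagonal, and the threshold `N₁`
  obtain ⟨E, hEdef⟩ : ∃ E : ℝ, E = min (1 / 4 : ℝ) (g / 4) := ⟨_, rfl⟩
  have hE0 : 0 < E := by rw [hEdef]; exact lt_min (by norm_num) (by linarith)
  have hE4 : E ≤ 1 / 4 := by rw [hEdef]; exact min_le_left _ _
  have hEg : E ≤ g / 4 := by rw [hEdef]; exact min_le_right _ _
  obtain ⟨N₁, hN₁⟩ : ∃ N₁ : ℕ, (2 * (4 / g + 2) : ℝ) ≤ N₁ := ⟨_, Nat.le_ceil _⟩
  obtain ⟨N', hN', r, hres, hsize⟩ := hD E hE0 (max N₀ N₁)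
  have hN'₀ : N₀ ≤ N' := (le_max_left _ _).trans hN'
  have hN'₁ : (2 * (4 / g + 2) : ℝ) ≤ N' :=
    hN₁.trans (by exact_mod_cast (le_max_right _ _).trans hN')
  -- `2^k ≤ r < 2^(k+1)`
  have h3pos : (0 : ℝ) < (3 : ℝ) ^ ((1 - E) * (N' : ℝ)) := Real.rpow_pos_of_pos (by norm_num) _
  have hr0 : 0 < r := Nat.cast_pos.1 (h3pos.trans_le hsize)
  obtain ⟨k, hk1, hk2⟩ : ∃ k : ℕ, 2 ^ k ≤ r ∧ r < 2 ^ (k + 1) :=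
    ⟨Nat.log 2 r, Nat.pow_log_le_self 2 hr0.ne', Nat.lt_pow_succ_log_self (by norm_num) r⟩
  -- (A) `(1-E) N' log 3 < (k+1) log 2`
  have hA : (1 - E) * (N' : ℝ) * Real.log 3 < ((k : ℝ) + 1) * Real.log 2 := by
    have h1 : Real.log ((3 : ℝ) ^ ((1 - E) * (N' : ℝ))) ≤ Real.log r := Real.log_le_log h3pos hsize
    rw [Real.log_rpow (by norm_num)] at h1
    have h2 : Real.log (r : ℝ) < Real.log ((2 : ℝ) ^ (k + 1)) :=
      Real.log_lt_log (Nat.cast_pos.2 hr0) (by exact_mod_cast hk2)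
    rw [Real.log_pow] at h2
    push_cast at h2
    linarith
  -- `k ≥ 4/g` (hence `k ≥ 1`)
  have hKM : (3 / 4 : ℝ) * N' < k + 1 := by
    have hN'0 : (0 : ℝ) ≤ N' := Nat.cast_nonneg _
    have h1 : (3 / 4 : ℝ) * ((N' : ℝ) * Real.log 3) ≤ (1 - E) * ((N' : ℝ) * Real.log 3) :=
      mul_le_mul_of_nonneg_right (by linarith) (mul_nonneg hN'0 hL3.le)
    have h2 : ((k : ℝ) + 1) * Real.log 2 ≤ ((k : ℝ) + 1) * Real.log 3 :=
      mul_le_mul_of_nonneg_left hL23 (by positivity)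
    exact lt_of_mul_lt_mul_right (by linarith : (3 / 4 : ℝ) * N' * Real.log 3 < (k + 1) * Real.log 3)
      hL3.le
  have h4g : 0 < 4 / g := div_pos (by norm_num) hgpos
  have hKg : 4 / g ≤ (k : ℝ) := by linarith
  have hk4g : 4 ≤ (k : ℝ) * g := by rwa [div_le_iff₀ hgpos] at hKg
  have hk1' : 1 ≤ k := by
    have h44 : (4 : ℝ) < 4 / g := by rw [lt_div_iff₀ hgpos]; linarith
    exact_mod_cast (by linarith : (1 : ℝ) ≤ k)
  -- the restriction `cw₂^{⊠(k+N')} ≥ ⟨2^k, 2^k, 2^k⟩`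
  have hchain : TensorRestrictsTo (kroneckerPow (cwTensor ℂ 2) (k + N'))
      (matMulTensor ℂ (2 ^ k) (2 ^ k) (2 ^ k)) :=
    (cwPow_add_restrictsTo k N').trans
      (((TensorRestrictsTo.refl _).kronecker
          (hres.trans (tensorRestrictsTo_unitTensor_castLE (K := ℂ) hk1))).trans (halfMM_pow' hk1'))
  -- the exponent inequality `(k + N') Θ ≤ k`
  have hmain : ((k : ℝ) + N') * Θ ≤ k := by
    have hA' : (1 - E) * (N' : ℝ) < ((k : ℝ) + 1) * Λ := by
      have : (1 - E) * (N' : ℝ) * Real.log 3 < ((k : ℝ) + 1) * Λ * Real.log 3 := by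
        rw [mul_assoc ((k : ℝ) + 1), hΛL]; exact hA
      exact lt_of_mul_lt_mul_right this hL3.le
    have h1 := mul_lt_mul_of_pos_right hA' hΘpos
    have hK0 : (0 : ℝ) ≤ k := Nat.cast_nonneg _
    have hKg' : (k : ℝ) * g = k - k * Θ - k * Θ * Λ := by rw [hg]; ring
    have ha3 : 0 ≤ (k : ℝ) * Θ * E := mul_nonneg (mul_nonneg hK0 hΘpos.le) hE0.le
    have hKE2 : (k : ℝ) * E ≤ k * (g / 4) := mul_le_mul_of_nonneg_left hEg hK0
    have h2 : ((k : ℝ) + N') * Θ * (1 - E) ≤ k * (1 - E) := by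
      nlinarith [h1, hKE2, ha3, hΘΛ1, hk4g, hKg']
    exact le_of_mul_le_mul_right h2 (by linarith)
  have hlog : ((k : ℝ) + N') * Real.log c ≤ k * Real.log 4 := by
    rw [← hΘL4, ← mul_assoc]
    exact mul_le_mul_of_nonneg_right hmain hL4pos.le
  refine ⟨k + N', by omega, 2 ^ k, hchain, ?_⟩
  have e4 : ((2 ^ k : ℕ) : ℝ) ^ 2 = (4 : ℝ) ^ k := by
    push_cast
    rw [← pow_mul, show k * 2 = 2 * k from mul_comm _ _, pow_mul]; norm_num
  have e1 : c ^ (k + N') = Real.exp (((k : ℝ) + N') * Real.log c) := by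
    rw [← Real.rpow_natCast, Real.rpow_def_of_pos hcpos]; congr 1; push_cast; ring
  have e2 : (4 : ℝ) ^ k = Real.exp ((k : ℝ) * Real.log 4) := by
    rw [← Real.rpow_natCast, Real.rpow_def_of_pos (by norm_num : (0 : ℝ) < 4)]; congr 1; ring
  rw [e4, e1, e2, Real.exp_le_exp]
  exact hlog


/-- `9/4 < 4^{log₆ 3}` (`⟺ log₂ 3 < 8/5 · …`; from `3⁵ = 243 < 256 = 2⁸`). [folklore] -/
theorem nine_fourths_lt_four_rpow_logb_six_three : (9 / 4 : ℝ) < (4 : ℝ) ^ Real.logb 6 3 := by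
  have hL2 : 0 < Real.log 2 := Real.log_pos one_lt_two
  have hL3 : 0 < Real.log 3 := Real.log_pos (by norm_num)
  have h85 : 5 * Real.log 3 < 8 * Real.log 2 := by
    have h := Real.log_lt_log (by norm_num : (0 : ℝ) < 3 ^ 5) (by norm_num : (3 : ℝ) ^ 5 < 2 ^ 8)
    rw [Real.log_pow, Real.log_pow] at h
    push_cast at h
    linarith
  have hL6 : Real.log 6 = Real.log 2 + Real.log 3 := by
    rw [show (6 : ℝ) = 2 * 3 by norm_num, Real.log_mul (by norm_num) (by norm_num)]
  have hL4 : Real.log 4 = 2 * Real.log 2 := by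
    rw [show (4 : ℝ) = 2 ^ 2 by norm_num, Real.log_pow]; push_cast; ring
  have hL94 : Real.log (9 / 4) = 2 * Real.log 3 - 2 * Real.log 2 := by
    rw [Real.log_div (by norm_num) (by norm_num), show (9 : ℝ) = 3 ^ 2 by norm_num,
      show (4 : ℝ) = 2 ^ 2 by norm_num, Real.log_pow, Real.log_pow]; push_cast; ring
  rw [← Real.log_lt_log_iff (by norm_num) (Real.rpow_pos_of_pos (by norm_num) _),
    Real.log_rpow (by norm_num), Real.logb, hL6, hL4, hL94, div_mul_eq_mul_div,
    lt_div_iff₀ (by positivity)]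
  nlinarith [mul_lt_mul_of_pos_left h85 hL2, mul_lt_mul_of_pos_right h85 hL3]

end Rate

end Summit.MatrixMultiplication.MatrixMultiplication.Theorems.OutsiderSandwichHalfMM
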